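import Mathlib.Analysis.SpecialFunctions.JapaneseBracket
import Literature.Geometry.Lorentzian.AsymptoticFlatnessEnergy
import Literature.Geometry.Lorentzian.ADMFrameIndependence
import Literature.Geometry.Lorentzian.WeightedNorms
import HarnessLib

/-!
# ADM energy is pinned under finite weighted-Sobolev distance (Bartnik 1986 §4, linearised)

Let `e` be an end of an open `U ⊆ ℝ³` whose chart reads the metric components verbatim
(`hCoeff e D = hFun D` beyond the inner radius `R`, as for the Kerr–Schild end `Kerr.afEnd`) and
whose exterior region `{R < ‖x‖}` lies in `U`. If two initial data sets on `U` are at **finite**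
distance `InitialDataSet.dataWeightedSobolevEDist s δ D₁ D₂ < ∞` (`H^s_δ × H^{s-1}_{δ+1}`, `s ≥ 2`,
`δ ≥ 1`) and the ADM fluxes of `D₂` converge to `m`, then so do those of `D₁`
(`AFEnd.hasADMEnergy_of_dataWeightedSobolevEDist_lt_top`).

Proof (Bartnik, CPAM 39 (1986), §4, (4.2)–(4.4), Prop. 4.1, linearised; no Sobolev embedding):
beyond `R` the two ADM flux fields differ by the ADM field `V_f = ∑ᵢ (∑ⱼ (∂ⱼfᵢⱼ − ∂ᵢfⱼⱼ)) eᵢ` of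
`f = h₁ − h₂`, with `‖V_f‖ ≤ 18‖Df‖`, `|div V_f| ≤ 18‖D²f‖`; the weight `(1 + ‖x‖)^{2(δ+m)}`,
`2(δ+m) > 3`, turns the weighted `L²` bounds into `L¹` bounds
(`integrableOn_of_lintegral_weight_lt_top`: `g ≤ (w g² + w⁻¹)/2`, `integrable_one_add_norm`); and
an `L¹` field with `L¹` divergence has vanishing flux at infinity
(`tendsto_flux_atTop_of_integrableOn`: Gauss–Green on shells gives
`|A(c)| ≤ |A(r)| + ∫_{‖x‖>c} |div V|` for `c ≤ r ≤ c + 1`; averaging over `r` in polar coordinates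
gives `|A(c)| ≤ ∫_{‖x‖>c} (‖V‖ + |div V|) → 0`). Everything is proved; no definitions, no named
facts.

## References

* R. Bartnik, *The mass of an asymptotically flat manifold*, CPAM 39 (1986), §4, (4.2)–(4.4),
  Prop. 4.1, Thm. 4.2.
-/
noncomputable section

-- instance search on the nested operator spaces of metric components and their derivatives
-- (`E3 →L[ℝ] E3 →L[ℝ] E3 →L[ℝ] E3 →L[ℝ] ℝ`) is deep and slow on `E3`
-- (as in `AsymptoticFlatnessEnergy.lean`)
set_option maxSynthPendingDepth 3
set_option synthInstance.maxHeartbeats 200000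

open Manifold Bundle TopologicalSpace Filter Metric MeasureTheory Set
open scoped ContDiff Topology ENNReal RealInnerProductSpace

namespace Literature.Geometry.Lorentzian

/-! ### From weighted `L²` to `L¹` -/

/-- **Weighted `L²` controls `L¹` on `ℝ³` for weights `(1 + ‖x‖)^p`, `p > 3`.** If `g ≥ 0` is
continuous on the measurable set `Ω ⊆ ℝ³` and `∫_Ω (1 + ‖x‖)^p g² < ∞` with `p > 3`, then `g` is
integrable on `Ω` (dominate `g ≤ ((1+‖x‖)^p g² + (1+‖x‖)^{-p})/2` and use
`integrable_one_add_norm`; this replaces the Cauchy–Schwarz step of Bartnik 1986, Prop. 4.1).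
[folklore] -/
theorem integrableOn_of_lintegral_weight_lt_top {Ω : Set E3} (hΩ : MeasurableSet Ω)
    {g : E3 → ℝ} (hg : ContinuousOn g Ω) (hg0 : ∀ x, 0 ≤ g x) {p : ℝ} (hp : 3 < p)
    (hfin : ∫⁻ x in Ω, ENNReal.ofReal ((1 + ‖x‖) ^ p * g x ^ 2) < ⊤) :
    IntegrableOn g Ω volume := by
  have hw : ∀ x : E3, 0 < (1 + ‖x‖) ^ p := fun x ↦
    Real.rpow_pos_of_pos (add_pos_of_pos_of_nonneg one_pos (norm_nonneg x)) _
  have hwc : Continuous fun x : E3 ↦ (1 + ‖x‖) ^ p :=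
    (continuous_const.add continuous_norm).rpow_const fun x ↦
      Or.inl (add_pos_of_pos_of_nonneg one_pos (norm_nonneg x)).ne'
  have h1 : IntegrableOn (fun x ↦ (1 + ‖x‖) ^ p * g x ^ 2) Ω volume := by
    refine ⟨(hwc.continuousOn.mul (hg.pow 2)).aestronglyMeasurable hΩ, ?_⟩
    rw [hasFiniteIntegral_iff_ofReal]
    · exact hfin
    · exact ae_of_all _ fun x ↦ mul_nonneg (hw x).le (sq_nonneg _)
  have h2 : IntegrableOn (fun x : E3 ↦ (1 + ‖x‖) ^ (-p)) Ω volume := by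
    have hfr : (Module.finrank ℝ E3 : ℝ) < p := by simpa using hp
    exact (integrable_one_add_norm hfr).integrableOn
  have hdom : IntegrableOn (fun x ↦ ((1 + ‖x‖) ^ p * g x ^ 2 + (1 + ‖x‖) ^ (-p)) / 2) Ω volume :=
    (h1.add h2).div_const 2
  refine Integrable.mono' hdom (hg.aestronglyMeasurable hΩ) (ae_of_all _ fun x ↦ ?_)
  rw [Real.norm_of_nonneg (hg0 x), Real.rpow_neg (by positivity),
    le_div_iff₀ (by norm_num : (0 : ℝ) < 2)]
  -- AM–GM: `2 g ≤ w g² + w⁻¹`, i.e. `0 ≤ (w g − 1)²`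
  refine le_of_mul_le_mul_left ?_ (hw x)
  rw [mul_add, mul_inv_cancel₀ (hw x).ne']
  nlinarith [sq_nonneg ((1 + ‖x‖) ^ p * g x - 1)]

/-- Finiteness of the weighted Sobolev seminorm gives finiteness of each weighted `L²` term
`∫_U (1 + ‖x‖)^{2(δ+m)} ‖D^m f‖²`, `m ≤ s` (Bartnik 1986, (1.2)). [folklore] -/
theorem lintegral_lt_top_of_weightedSobolevSeminorm_lt_top {U : Set E3} {s : ℕ} {δ : ℝ}
    {f : E3 → E3 →L[ℝ] E3 →L[ℝ] ℝ} (h : weightedSobolevSeminorm U s δ f < ⊤) {m : ℕ}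
    (hm : m ≤ s) :
    ∫⁻ x in U, ENNReal.ofReal ((1 + ‖x‖) ^ (2 * (δ + m) : ℝ) * ‖iteratedFDeriv ℝ m f x‖ ^ 2) <
      ⊤ := by
  rw [weightedSobolevSeminorm] at h
  have h' := (ENNReal.rpow_lt_top_iff_of_pos (by norm_num : (0 : ℝ) < 1 / 2)).1 h
  exact ENNReal.sum_lt_top.1 h' m (Finset.mem_range.2 (Nat.lt_succ_of_le hm))

/-! ### An `L¹` field with `L¹` divergence has vanishing flux at infinity -/

/-- **Vanishing of the flux at infinity.** Let `W` be a `C¹` vector field on `ℝ³` which, together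
with its divergence `tr DW`, is integrable on `{R₂ < ‖x‖}` (`R₂ > 0`). Then the flux
`A(r) = r² ∮ ⟨x/‖x‖, W⟩|_{x = rα} dσ(α)` tends to `0` as `r → ∞`: by Gauss–Green on the shell
`{c < ‖x‖ < r}` (`FluidPDE.setIntegral_shell_divergence_eq`), `|A(c)| ≤ |A(r)| + ∫_{‖x‖>c} |tr DW|`
for `c ≤ r ≤ c + 1`; averaging over `r` and using polar coordinates on the shell
(`FluidPDE.setIntegral_shell_eq_integral_sphereIntegral`),
`|A(c)| ≤ ∫_{‖x‖>c} ‖W‖ + ∫_{‖x‖>c} |tr DW| → 0`. This is the flux-comparison step of Bartnik's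
Prop. 4.1 for an `L¹` field. [cite: Bartnik1986CPAM, §4 (4.2)–(4.4), Prop. 4.1] -/
theorem tendsto_flux_atTop_of_integrableOn {W : E3 → E3} (hW : ContDiff ℝ 1 W) {R₂ : ℝ}
    (hR₂ : 0 < R₂) (hWi : IntegrableOn W {x | R₂ < ‖x‖} volume)
    (hLi : IntegrableOn (fun x ↦ LinearMap.trace ℝ E3 (fderiv ℝ W x : E3 →ₗ[ℝ] E3))
      {x | R₂ < ‖x‖} volume) :
    Tendsto (fun r : ℝ ↦ r ^ (Module.finrank ℝ E3 - 1) *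
      Analysis.FluidPDE.sphereIntegral (volume : Measure E3) (fun x ↦ ⟪‖x‖⁻¹ • x, W x⟫) r)
      atTop (𝓝 0) := by
  set L : E3 → ℝ := fun x ↦ LinearMap.trace ℝ E3 (fderiv ℝ W x : E3 →ₗ[ℝ] E3) with hL
  set A : ℝ → ℝ := fun r ↦ r ^ (Module.finrank ℝ E3 - 1) *
    Analysis.FluidPDE.sphereIntegral (volume : Measure E3) (fun x ↦ ⟪‖x‖⁻¹ • x, W x⟫) r with hA
  set N : ℝ → ℝ := fun r ↦ r ^ (Module.finrank ℝ E3 - 1) *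
    Analysis.FluidPDE.sphereIntegral (volume : Measure E3) (fun x ↦ ‖W x‖) r with hN
  have hmeas : ∀ c : ℝ, MeasurableSet {x : E3 | c < ‖x‖} := fun c ↦
    (isOpen_lt continuous_const continuous_norm).measurableSet
  -- the tails of the two integrable functions tend to zero
  set τ : ℝ → ℝ := fun c ↦ (∫ x in {x : E3 | c < ‖x‖}, ‖W x‖) + ∫ x in {x : E3 | c < ‖x‖}, |L x|
    with hτ
  have htail : ∀ g : E3 → ℝ, IntegrableOn g {x : E3 | R₂ < ‖x‖} volume →
      Tendsto (fun c : ℝ ↦ ∫ x in {x : E3 | c < ‖x‖}, g x) atTop (𝓝 0) := by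
    intro g hg
    have hanti : Antitone fun c : ℝ ↦ {x : E3 | c < ‖x‖} :=
      fun c d hcd x (hx : d < ‖x‖) ↦ show c < ‖x‖ from lt_of_le_of_lt hcd hx
    have hempty : (⋂ c : ℝ, {x : E3 | c < ‖x‖}) = ∅ := by
      ext x
      simp only [mem_iInter, mem_setOf_eq, mem_empty_iff_false, iff_false, not_forall, not_lt]
      exact ⟨‖x‖, le_rfl⟩
    have h1 := tendsto_setIntegral_of_antitone (μ := (volume : Measure E3)) (f := g) hmeas hanti
      ⟨R₂, hg⟩
    rwa [hempty, Measure.restrict_empty, integral_zero_measure] at h1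
  have hWnorm : IntegrableOn (fun x ↦ ‖W x‖) {x : E3 | R₂ < ‖x‖} volume := hWi.norm
  have hLabs : IntegrableOn (fun x ↦ |L x|) {x : E3 | R₂ < ‖x‖} volume := hLi.abs
  have hτ0 : Tendsto τ atTop (𝓝 0) := by simpa using (htail _ hWnorm).add (htail _ hLabs)
  -- `|A r| ≤ N r` for `r ≥ 0`
  have hsphere_int : ∀ r : ℝ, Integrable (fun α : sphere (0 : E3) 1 ↦ ‖W (r • (α : E3))‖)
      (volume : Measure E3).toSphere := by
    intro r
    have hg : Continuous fun α : sphere (0 : E3) 1 ↦ r • (α : E3) := by fun_prop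
    have hc : Continuous fun α : sphere (0 : E3) 1 ↦ ‖W (r • (α : E3))‖ :=
      (hW.continuous.comp hg).norm
    exact integrableOn_univ.1 (hc.continuousOn.integrableOn_compact isCompact_univ)
  have hAN : ∀ r, 0 ≤ r → |A r| ≤ N r := by
    intro r hr
    simp only [hA, hN, abs_mul, abs_pow, abs_of_nonneg hr]
    refine mul_le_mul_of_nonneg_left ?_ (pow_nonneg hr _)
    rw [Analysis.FluidPDE.sphereIntegral_def, Analysis.FluidPDE.sphereIntegral_def,
      ← Real.norm_eq_abs]
    refine norm_integral_le_of_norm_le (hsphere_int r) (ae_of_all _ fun α ↦ ?_)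
    rw [Real.norm_eq_abs]
    calc |⟪‖r • (α : E3)‖⁻¹ • (r • (α : E3)), W (r • (α : E3))⟫|
        ≤ ‖‖r • (α : E3)‖⁻¹ • (r • (α : E3))‖ * ‖W (r • (α : E3))‖ := abs_real_inner_le_norm _ _
      _ ≤ 1 * ‖W (r • (α : E3))‖ := by
          gcongr
          by_cases h0 : r • (α : E3) = 0
          · simp [h0]
          · rw [norm_smul, norm_inv, norm_norm, inv_mul_cancel₀ (norm_ne_zero_iff.2 h0)]
      _ = ‖W (r • (α : E3))‖ := one_mul _
  -- Gauss–Green: `|A c| ≤ |A r| + ∫_{‖x‖ > c} |L|` for `R₂ ≤ c ≤ r`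
  have hGG : ∀ c r, R₂ ≤ c → c ≤ r → |A c| ≤ |A r| + ∫ x in {x : E3 | c < ‖x‖}, |L x| := by
    intro c r hc hcr
    have hc0 : 0 < c := hR₂.trans_le hc
    have key := Analysis.FluidPDE.setIntegral_shell_divergence_eq (volume : Measure E3) hW hc0 hcr
    have hsub : {x : E3 | c < ‖x‖ ∧ ‖x‖ < r} ⊆ {x : E3 | c < ‖x‖} := fun x hx ↦ hx.1
    have hIc : IntegrableOn (fun x ↦ |L x|) {x : E3 | c < ‖x‖} volume :=
      hLabs.mono_set fun x (hx : c < ‖x‖) ↦ show R₂ < ‖x‖ from lt_of_le_of_lt hc hx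
    have hdiff : A r - A c = ∫ x in {x : E3 | c < ‖x‖ ∧ ‖x‖ < r}, L x := by
      simp only [hA, hL]
      linarith [key]
    have hbound : |A r - A c| ≤ ∫ x in {x : E3 | c < ‖x‖}, |L x| := by
      rw [hdiff]
      calc |∫ x in {x : E3 | c < ‖x‖ ∧ ‖x‖ < r}, L x|
          ≤ ∫ x in {x : E3 | c < ‖x‖ ∧ ‖x‖ < r}, |L x| := abs_integral_le_integral_abs
        _ ≤ ∫ x in {x : E3 | c < ‖x‖}, |L x| :=
            setIntegral_mono_set hIc (ae_of_all _ fun x ↦ abs_nonneg _) (ae_of_all _ hsub)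
    have h3 := abs_sub_abs_le_abs_sub (A c) (A r)
    rw [abs_sub_comm] at h3
    linarith
  -- averaging over `r ∈ (c, c + 1)` and polar coordinates on the shell
  have hmain : ∀ c, R₂ ≤ c → |A c| ≤ τ c := by
    intro c hc
    have hc0 : 0 < c := hR₂.trans_le hc
    have hNc : Continuous N :=
      (continuous_pow _).mul (Analysis.FluidPDE.continuous_sphereIntegral _ hW.continuous.norm)
    have hNi : IntegrableOn N (Ioo c (c + 1)) volume :=
      hNc.integrableOn_Icc.mono_set Ioo_subset_Icc_self
    have hpt : ∀ r ∈ Ioo c (c + 1), |A c| - (∫ x in {x : E3 | c < ‖x‖}, |L x|) ≤ N r := by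
      intro r hr
      have h1 := hGG c r hc hr.1.le
      have h2 := hAN r (hc0.trans hr.1).le
      linarith
    have hint : (∫ _ in Ioo c (c + 1), (|A c| - ∫ x in {x : E3 | c < ‖x‖}, |L x|)) ≤
        ∫ r in Ioo c (c + 1), N r :=
      setIntegral_mono_on (integrableOn_const (by simp)) hNi measurableSet_Ioo hpt
    rw [setIntegral_const, Real.volume_real_Ioo, show c + 1 - c = (1 : ℝ) by ring,
      max_eq_left zero_le_one, one_smul] at hint
    have hWs : IntegrableOn (fun x ↦ ‖W x‖) {x : E3 | c < ‖x‖ ∧ ‖x‖ < c + 1} volume :=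
      hWnorm.mono_set fun x hx ↦ show R₂ < ‖x‖ from lt_of_le_of_lt hc hx.1
    have hshell : ∫ r in Ioo c (c + 1), N r = ∫ x in {x : E3 | c < ‖x‖ ∧ ‖x‖ < c + 1}, ‖W x‖ := by
      rw [Analysis.FluidPDE.setIntegral_shell_eq_integral_sphereIntegral (volume : Measure E3)
        hWs hc0.le]
      rfl
    have hshell_le : ∫ x in {x : E3 | c < ‖x‖ ∧ ‖x‖ < c + 1}, ‖W x‖ ≤
        ∫ x in {x : E3 | c < ‖x‖}, ‖W x‖ :=
      setIntegral_mono_set (hWnorm.mono_set fun x (hx : c < ‖x‖) ↦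
          show R₂ < ‖x‖ from lt_of_le_of_lt hc hx)
        (ae_of_all _ fun x ↦ norm_nonneg _) (ae_of_all _ fun x hx ↦ hx.1)
    simp only [hτ]
    linarith
  refine squeeze_zero_norm' ?_ hτ0
  filter_upwards [eventually_ge_atTop R₂] with c hc
  rw [Real.norm_eq_abs]
  exact hmain c hc

/-! ### ADM pinning on an end with the identity chart -/

namespace AFEnd

/-- **ADM pinning by a finite weighted Sobolev distance (identity-chart ends).** Let `e` be an
end of an open `U ⊆ ℝ³` whose chart reads the metric components verbatim
(`hCoeff e D = hFun D` beyond `R`, as for `Kerr.afEnd`) and whose exterior region lies in `U`.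
If two data sets on `U` are at finite `H^s_δ × H^{s-1}_{δ+1}` distance with `s ≥ 2`, `δ ≥ 1`, and
the ADM fluxes of `D₂` converge to `m`, then so do those of `D₁`: the flux difference is the flux of
the ADM field of `f = h₁ − h₂`, an `L¹` field with `L¹` divergence
(`tendsto_flux_atTop_of_integrableOn`). Bartnik, CPAM 39 (1986), §4, (4.2)–(4.4) and Prop. 4.1
(linearised). [cite: Bartnik1986CPAM, §4 (4.2)–(4.4), Prop. 4.1] -/
theorem hasADMEnergy_of_dataWeightedSobolevEDist_lt_top {U : Opens E3} (e : AFEnd U)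
    (hcoeff : ∀ (D : InitialDataSet 𝓘(ℝ, E3) U) (z : E3), e.R < ‖z‖ → AFEnd.hCoeff e D z = D.hFun z)
    (hU : {z : E3 | e.R < ‖z‖} ⊆ (U : Set E3)) (D₁ D₂ : InitialDataSet 𝓘(ℝ, E3) U)
    {s : ℕ} {δ : ℝ} (hs : 2 ≤ s) (hδ : 1 ≤ δ)
    (hdist : InitialDataSet.dataWeightedSobolevEDist s δ D₁ D₂ < ⊤) {m : ℝ}
    (h₂ : e.HasADMEnergy D₂ m) : e.HasADMEnergy D₁ m := by
  classical
  set b := EuclideanSpace.basisFun (Fin 3) ℝ with hb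
  have hopen (c : ℝ) : IsOpen {z : E3 | c < ‖z‖} := isOpen_lt continuous_const continuous_norm
  have hmeas (c : ℝ) : MeasurableSet {x : E3 | c < ‖x‖} := (hopen c).measurableSet
  set F : E3 → E3 →L[ℝ] E3 →L[ℝ] ℝ := fun z ↦ AFEnd.hCoeff e D₁ z - AFEnd.hCoeff e D₂ z with hF
  set f : E3 → E3 →L[ℝ] E3 →L[ℝ] ℝ := D₁.hFun - D₂.hFun with hf
  have hFf : ∀ z, e.R < ‖z‖ → F z = f z := fun z hz ↦ by
    simp only [hF, hf, Pi.sub_apply, hcoeff D₁ z hz, hcoeff D₂ z hz]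
  have hFf_ev : ∀ z, e.R < ‖z‖ → F =ᶠ[𝓝 z] f := fun z hz ↦ by
    filter_upwards [(hopen e.R).mem_nhds hz] with y hy using hFf y hy
  have hFsmooth : ∀ z, e.R < ‖z‖ → ContDiffAt ℝ ∞ F z := fun z hz ↦
    (e.contDiffAt_hCoeff D₁ hz).sub (e.contDiffAt_hCoeff D₂ hz)
  have hDFf : ∀ (n : ℕ) (z : E3), e.R < ‖z‖ → iteratedFDeriv ℝ n F z = iteratedFDeriv ℝ n f z :=
    fun n z hz ↦ ((hFf_ev z hz).iteratedFDeriv ℝ n).eq_of_nhds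
  -- the ADM fields of `D₁`, `D₂` and of the difference `F`
  set V₁ : E3 → E3 := fun x ↦ ∑ i, (∑ j, (AFEnd.partialH e D₁ j i j x -
    AFEnd.partialH e D₁ i j j x)) • b i with hV₁
  set V₂ : E3 → E3 := fun x ↦ ∑ i, (∑ j, (AFEnd.partialH e D₂ j i j x -
    AFEnd.partialH e D₂ i j j x)) • b i with hV₂
  set VF : E3 → E3 := fun y ↦ ∑ i, (∑ j, (fderiv ℝ (fun z ↦ F z (b i) (b j)) y (b j) -
    fderiv ℝ (fun z ↦ F z (b j) (b j)) y (b i))) • b i with hVF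
  have hVFr : ∀ y, VF y = ∑ i, (∑ j, (fderiv ℝ (fun z ↦ F z (b i) (b j)) y (b j) -
      fderiv ℝ (fun z ↦ F z (b j) (b j)) y (b i))) • b i := fun y ↦ rfl
  obtain ⟨W₁, hW₁, hW₁V⟩ := e.exists_contDiff_extension D₁ V₁ fun _ ↦ rfl
  obtain ⟨W₂, hW₂, hW₂V⟩ := e.exists_contDiff_extension D₂ V₂ fun _ ↦ rfl
  set W : E3 → E3 := fun x ↦ W₁ x - W₂ x with hWdef
  have hW : ContDiff ℝ 1 W := hW₁.sub hW₂
  have hdiffH : ∀ (D : InitialDataSet 𝓘(ℝ, E3) U) (x : E3), e.R < ‖x‖ →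
      DifferentiableAt ℝ (AFEnd.hCoeff e D) x := fun D x hx ↦
    (e.contDiffAt_hCoeff D hx).differentiableAt (by simp)
  have hdiffF : ∀ x, e.R < ‖x‖ → DifferentiableAt ℝ F x := fun x hx ↦
    (hdiffH D₁ x hx).sub (hdiffH D₂ x hx)
  have hVF_eq : ∀ x, e.R < ‖x‖ → VF x = admVecOf b (fderiv ℝ F x) := fun x hx ↦
    admVec_eq_admVecOf b hVFr (hdiffF x hx)
  have hWVF : ∀ x, e.R + 2 ≤ ‖x‖ → W x = VF x := by
    intro x hx
    have hxR : e.R < ‖x‖ := by linarith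
    simp only [hWdef, hW₁V x hx, hW₂V x hx]
    rw [admVec_eq_admVecOf b (e.admVec_repr D₁ V₁ fun _ ↦ rfl) (hdiffH D₁ x hxR),
      admVec_eq_admVecOf b (e.admVec_repr D₂ V₂ fun _ ↦ rfl) (hdiffH D₂ x hxR), hVF_eq x hxR,
      ← admVecOf_sub, hF, fderiv_fun_sub (hdiffH D₁ x hxR) (hdiffH D₂ x hxR)]
  -- pointwise bounds: `‖W‖ ≤ 18 ‖DF‖`, `|div W| ≤ 18 ‖D²F‖` beyond `R + 2`
  have hcard : 2 * (Fintype.card (Fin 3) : ℝ) ^ 2 = 18 := by norm_num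
  have hWbound : ∀ x, e.R + 2 < ‖x‖ → ‖W x‖ ≤ 18 * ‖iteratedFDeriv ℝ 1 F x‖ := by
    intro x hx
    rw [hWVF x hx.le, hVF_eq x (by linarith), norm_iteratedFDeriv_one, ← hcard]
    exact norm_admVecOf_le b (fderiv ℝ F x)
  have hLbound : ∀ x, e.R + 2 < ‖x‖ →
      |LinearMap.trace ℝ E3 (fderiv ℝ W x : E3 →ₗ[ℝ] E3)| ≤ 18 * ‖iteratedFDeriv ℝ 2 F x‖ := by
    intro x hx
    have heq : W =ᶠ[𝓝 x] VF := by
      filter_upwards [(hopen (e.R + 2)).mem_nhds hx] with y hy using hWVF y (le_of_lt hy)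
    rw [heq.fderiv_eq]
    have hF2 : ContDiffAt ℝ 2 F x :=
      (hFsmooth x (by linarith)).of_le (WithTop.coe_le_coe.mpr le_top)
    rw [trace_fderiv_admVec b hVFr hF2]
    set C := fderiv ℝ (fderiv ℝ F) x with hC
    have hCb : ∀ a' u v w, |C (b a') (b u) (b v) (b w)| ≤ ‖C‖ := abs_fderiv_fderiv_apply_le b x
    have hnorm : ‖C‖ = ‖iteratedFDeriv ℝ 2 F x‖ := by
      rw [hC, ← norm_iteratedFDeriv_fderiv, norm_iteratedFDeriv_one]
    calc |∑ i, ∑ k, (C (b i) (b k) (b i) (b k) - C (b i) (b i) (b k) (b k))|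
        ≤ ∑ i, |∑ k, (C (b i) (b k) (b i) (b k) - C (b i) (b i) (b k) (b k))| :=
          Finset.abs_sum_le_sum_abs _ _
      _ ≤ ∑ _i : Fin 3, ∑ _k : Fin 3, (‖C‖ + ‖C‖) := by
          refine Finset.sum_le_sum fun i _ ↦ (Finset.abs_sum_le_sum_abs _ _).trans
            (Finset.sum_le_sum fun k _ ↦ ?_)
          exact (abs_sub _ _).trans (add_le_add (hCb i k i k) (hCb i i k k))
      _ = 18 * ‖iteratedFDeriv ℝ 2 F x‖ := by
          simp only [Finset.sum_const, Finset.card_univ, Fintype.card_fin, nsmul_eq_mul, hnorm]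
          push_cast
          ring
  -- the weighted `L²` terms of `F` (orders `1`, `2`) are finite on the exterior region
  have hsemi : weightedSobolevSeminorm (U : Set E3) s δ f < ⊤ := lt_of_le_of_lt le_self_add hdist
  have hterm : ∀ n : ℕ, n ≤ s → ∫⁻ x in {x : E3 | e.R < ‖x‖},
      ENNReal.ofReal ((1 + ‖x‖) ^ (2 * (δ + n) : ℝ) * ‖iteratedFDeriv ℝ n F x‖ ^ 2) < ⊤ := by
    intro n hn
    refine lt_of_le_of_lt ?_ (lintegral_lt_top_of_weightedSobolevSeminorm_lt_top hsemi hn)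
    calc ∫⁻ x in {x : E3 | e.R < ‖x‖},
          ENNReal.ofReal ((1 + ‖x‖) ^ (2 * (δ + n) : ℝ) * ‖iteratedFDeriv ℝ n F x‖ ^ 2)
        = ∫⁻ x in {x : E3 | e.R < ‖x‖},
          ENNReal.ofReal ((1 + ‖x‖) ^ (2 * (δ + n) : ℝ) * ‖iteratedFDeriv ℝ n f x‖ ^ 2) :=
          setLIntegral_congr_fun (hmeas e.R) fun x hx ↦ by rw [hDFf n x hx]
      _ ≤ ∫⁻ x in (U : Set E3),
          ENNReal.ofReal ((1 + ‖x‖) ^ (2 * (δ + n) : ℝ) * ‖iteratedFDeriv ℝ n f x‖ ^ 2) :=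
          lintegral_mono_set hU
  have hcontD : ∀ n : ℕ, ContinuousOn (fun x ↦ ‖iteratedFDeriv ℝ n F x‖) {x : E3 | e.R < ‖x‖} :=
    fun n x hx ↦ ((hFsmooth x hx).iteratedFDeriv_right (m := 0) (i := n)
      (by exact_mod_cast le_top)).continuousAt.norm.continuousWithinAt
  have hIntD : ∀ n : ℕ, 1 ≤ n → n ≤ s →
      IntegrableOn (fun x ↦ ‖iteratedFDeriv ℝ n F x‖) {x : E3 | e.R < ‖x‖} volume := by
    intro n hn1 hns
    refine integrableOn_of_lintegral_weight_lt_top (hmeas e.R) (hcontD n) (fun x ↦ norm_nonneg _)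
      (p := 2 * (δ + n)) ?_ (hterm n hns)
    have : (1 : ℝ) ≤ n := by exact_mod_cast hn1
    linarith
  -- `W` and `div W` are integrable beyond `R₂ = R + 2`
  set R₂ : ℝ := e.R + 2 with hR₂def
  have hR₂ : 0 < R₂ := by have := e.R_pos; rw [hR₂def]; linarith
  have hsub₂ : {x : E3 | R₂ < ‖x‖} ⊆ {x : E3 | e.R < ‖x‖} := fun x (hx : e.R + 2 < ‖x‖) ↦
    show e.R < ‖x‖ by linarith
  have hWi : IntegrableOn W {x : E3 | R₂ < ‖x‖} volume := by
    refine Integrable.mono' (((hIntD 1 le_rfl (by omega)).mono_set hsub₂).const_mul 18)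
      hW.continuous.aestronglyMeasurable ?_
    exact (ae_restrict_iff' (hmeas R₂)).2 (ae_of_all _ fun x hx ↦ hWbound x hx)
  have hLi : IntegrableOn (fun x ↦ LinearMap.trace ℝ E3 (fderiv ℝ W x : E3 →ₗ[ℝ] E3))
      {x : E3 | R₂ < ‖x‖} volume := by
    refine Integrable.mono' (((hIntD 2 (by norm_num) hs).mono_set hsub₂).const_mul 18)
      (Analysis.FluidPDE.continuous_trace_fderiv hW).aestronglyMeasurable ?_
    exact (ae_restrict_iff' (hmeas R₂)).2 (ae_of_all _ fun x hx ↦ by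
      rw [Real.norm_eq_abs]; exact hLbound x hx)
  have hA := tendsto_flux_atTop_of_integrableOn hW hR₂ hWi hLi
  -- the flux difference is `κ A(r)` for large `r`
  set κ : ℝ := (16 * Real.pi)⁻¹ *
    (((μHE[2] : Measure E3) (sphere (0 : E3) 1) / (volume : Measure E3).toSphere Set.univ).toReal)
    with hκ
  have hint : ∀ (W' : E3 → E3), ContDiff ℝ 1 W' → ∀ {r : ℝ}, 0 < r →
      Integrable (fun θ : sphere (0 : E3) 1 ↦
        ⟪‖r • (θ : E3)‖⁻¹ • (r • (θ : E3)), W' (r • (θ : E3))⟫) (volume : Measure E3).toSphere := by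
    intro W' hW' r hr
    have hg : Continuous fun θ : sphere (0 : E3) 1 ↦ r • (θ : E3) := by fun_prop
    have hc : Continuous fun θ : sphere (0 : E3) 1 ↦
        ⟪‖r • (θ : E3)‖⁻¹ • (r • (θ : E3)), W' (r • (θ : E3))⟫ :=
      ((hg.norm.inv₀ fun θ ↦ by
        rw [Analysis.FluidPDE.norm_smul_sphere hr.le θ]; exact hr.ne').smul hg).inner
        (hW'.continuous.comp hg)
    exact integrableOn_univ.1 (hc.continuousOn.integrableOn_compact isCompact_univ)
  have hflux : ∀ᶠ r in atTop, e.admEnergyFlux D₁ r - e.admEnergyFlux D₂ r =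
      κ * (r ^ (Module.finrank ℝ E3 - 1) *
        Analysis.FluidPDE.sphereIntegral (volume : Measure E3) (fun x ↦ ⟪‖x‖⁻¹ • x, W x⟫) r) := by
    filter_upwards [eventually_ge_atTop (e.R + 2), eventually_gt_atTop (0 : ℝ)] with r hr hr0
    rw [e.admEnergyFlux_eq_sphereIntegral D₁ V₁ (fun _ ↦ rfl) hr0,
      e.admEnergyFlux_eq_sphereIntegral D₂ V₂ (fun _ ↦ rfl) hr0]
    have hd : Module.finrank ℝ E3 - 1 = 2 := by simp
    rw [hd]
    have hS : ∀ (V W' : E3 → E3), (∀ x, e.R + 2 ≤ ‖x‖ → W' x = V x) →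
        Analysis.FluidPDE.sphereIntegral (volume : Measure E3) (fun x ↦ ⟪‖x‖⁻¹ • x, V x⟫) r =
          Analysis.FluidPDE.sphereIntegral (volume : Measure E3)
            (fun x ↦ ⟪‖x‖⁻¹ • x, W' x⟫) r := by
      intro V W' hWV
      simp only [Analysis.FluidPDE.sphereIntegral_def]
      refine integral_congr_ae (ae_of_all _ fun θ ↦ ?_)
      dsimp only
      rw [hWV _ (by rw [Analysis.FluidPDE.norm_smul_sphere hr0.le θ]; exact hr)]
    rw [hS V₁ W₁ hW₁V, hS V₂ W₂ hW₂V]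
    have hlin : Analysis.FluidPDE.sphereIntegral (volume : Measure E3)
          (fun x ↦ ⟪‖x‖⁻¹ • x, W₁ x⟫) r -
        Analysis.FluidPDE.sphereIntegral (volume : Measure E3) (fun x ↦ ⟪‖x‖⁻¹ • x, W₂ x⟫) r =
        Analysis.FluidPDE.sphereIntegral (volume : Measure E3) (fun x ↦ ⟪‖x‖⁻¹ • x, W x⟫) r := by
      simp only [Analysis.FluidPDE.sphereIntegral_def]
      rw [← integral_sub (hint W₁ hW₁ hr0) (hint W₂ hW₂ hr0)]
      refine integral_congr_ae (ae_of_all _ fun θ ↦ ?_)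
      simp only [hWdef, inner_sub_right]
    rw [← hlin]
    ring
  have hlim : Tendsto (fun r ↦ e.admEnergyFlux D₂ r + κ * (r ^ (Module.finrank ℝ E3 - 1) *
      Analysis.FluidPDE.sphereIntegral (volume : Measure E3) (fun x ↦ ⟪‖x‖⁻¹ • x, W x⟫) r))
      atTop (𝓝 (m + κ * 0)) := h₂.add (hA.const_mul κ)
  rw [mul_zero, add_zero] at hlim
  refine hlim.congr' ?_
  filter_upwards [hflux] with r hr
  linarith

end AFEnd

end Literature.Geometry.Lorentzian

end
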